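import Literature.Barriers.CriticalPhenomena.PlaquetteWalkHoleRootRowLawNoKiss
import Literature.Barriers.CriticalPhenomena.PlaquetteWalkHoleRootInteriorNoKill
import HarnessLib

/-!
# Barrier catalogue (SAWScalingLimit): the WOUND COST-`5` WITNESSES of the root row — the ROOT-ROW LAW as a closed theorem for every domain containing
the `(k+3) × 3` ring block («ROOT-ROW WITNESSES»)

`Z → ∞` limit model of the printed Yang–Baxter weights [GlazmanManolescu2019, §1, eq. (1)]; the «RECTANGLE COEFFICIENT» line of the venture lane
«pcv-sawmu» (b-engine-1 g26). `PlaquetteWalkHoleRootRowLawNoKiss.vertexFunctional_printed_zero_set_finite_of_rootRow` proves that the printed vertex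
functional `VF_D(w.side W, f₀; ·)` at a root-row rhombus `f₀ = (w.1 + k, w.2)` is not identically zero PROVIDED some wound class-`B2a` walk of limit cost `5`
exists at `f₀` (hypothesis `hex`). This file discharges `hex` structurally for `k ≤ 3`: the member 'ao' of the lane's census (kit j276221) — east along the
root row to `f₀`, turn `N`, west along the row above, down the column `w.1 − 2` past the hole, east along the row below, back into `f₀` from below — is
written down at the reference position `w = (4,2)` (§2, kernel certificates: class `B2a`, cost `5`, ONE mid-edge of the excursion on the eastern ray of the
hole ⇒ odd ray count ⇒ wound), and transported to every position by translation (§1: `cfgCount`/`cost` are translation invariant; §3, after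
`PlaquetteWalkHoleRootInteriorNoKill.exists_wound_witness_shift`). ★★★★★ `vertexFunctional_printed_exists_ne_zero_of_rowBlock`: for EVERY finite face list
`Dl` containing the block `rowBlock w k` (`k ≤ 3`; the cells `[w.1 − 2, w.1 + k] × [w.2 − 1, w.2 + 1]` minus the hole) and missing the hole
`(w.1 − 1, w.2)`, the printed vertex functional at `(w.1 + k, w.2)` is NOT identically zero on `(0, π)` — no hypothesis left.
[GlazmanManolescu2019 §1 Fig. 1, eq. (1), §4.2, Lemma 2.1, Remark 2.2; Glazman2015WeightedSAW Lemma 3.1 (proof, pp. 6–7); CourantRobbins1958 Ch. V App. §2]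
-/

noncomputable section

open Set Function Complex

namespace Literature.Probability.RandomPlanarGeometry.SAW.YangBaxter

open Real
open Literature.Barriers.CriticalPhenomena.PlaquetteWalk

open private side_jOut from Literature.Probability.RandomPlanarGeometry.YangBaxterSAWExcursionJordan

/-! ## §1 Translation invariance of the configuration counts and of the cost; the eastern-ray count at any rooted rhombus -/

/-- The visited-face list of a translated mid-edge list is the translated visited-face list. [cite: GlazmanManolescu2019, §4.2 (translation invariance)] -/
theorem facesL_map_shiftBy (v : ℤ × ℤ) (l : List MidEdge) : facesL (l.map (MidEdge.shiftBy v)) = (facesL l).map (Face.shiftBy v) := by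
  unfold facesL
  rw [arcsOf_map, List.filterMap_map]
  have e : (arcsOf l).filterMap (arcFace ∘ Prod.map (MidEdge.shiftBy v) (MidEdge.shiftBy v)) =
      ((arcsOf l).filterMap arcFace).map (Face.shiftBy v) := by
    rw [List.map_filterMap]
    refine List.filterMap_congr fun p _ => ?_
    simp only [Function.comp, arcFace_shiftBy]
  rw [e, List.dedup_map_of_injective (Face.shiftBy_injective v)]

/-- The arc kinds in a translated face of a translated mid-edge list are the arc kinds in the face. [cite: GlazmanManolescu2019, §4.2 (translation invariance)] -/
theorem kindsL_map_shiftBy (v : ℤ × ℤ) (l : List MidEdge) (f : Face) :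
    kindsL (l.map (MidEdge.shiftBy v)) (Face.shiftBy v f) = kindsL l f := by
  unfold kindsL
  rw [arcsOf_map, List.filterMap_map]
  refine List.filterMap_congr fun p _ => ?_
  simp only [Function.comp, arcFace_shiftBy, arcKindOf_shiftBy, Option.map_eq_some_iff]
  by_cases h : arcFace p = some f
  · rw [if_pos h, if_pos ⟨f, h, rfl⟩]
  · rw [if_neg h, if_neg]
    rintro ⟨g, hg, hgf⟩
    exact h (by rw [hg, Face.shiftBy_injective v hgf])

/-- ★ **The configuration counts are translation invariant.** [cite: GlazmanManolescu2019, §1 (Fig. 1, eq. (1)), §4.2 (translation invariance)] -/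
theorem cfgCount_map_shiftBy (v : ℤ × ℤ) (l : List MidEdge) (κ : List ArcKind) : cfgCount (l.map (MidEdge.shiftBy v)) κ = cfgCount l κ := by
  unfold cfgCount
  rw [facesL_map_shiftBy, List.countP_map]
  refine List.countP_congr fun f _ => ?_
  simp only [Function.comp, kindsL_map_shiftBy]

/-- ★ **The limit cost is translation invariant.** [cite: GlazmanManolescu2019, §1, eq. (1); Remark 2.2] -/
theorem cost_map_shiftBy (v : ℤ × ℤ) (l : List MidEdge) (s : Fin 4) : cost s (l.map (MidEdge.shiftBy v)) = cost s l := by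
  unfold cost; rw [cfgCount_map_shiftBy, cfgCount_map_shiftBy]

namespace ΩG

variable {D : Set Face} {w r : Face}

/-- **The eastern-ray count behind the hole root, in decidable form, at ANY rooted rhombus**: the number of excursion mid-edges `nth (F + j + 1)`, `j < Mv`, on
the eastern ray of the hole. [cite: CourantRobbins1958, Ch. V Appendix §2 (The Jordan Curve Theorem for Polygons: the even–odd rule)] -/
theorem rayCountAt_holeFaceW_E_eq_card_root (ω : ΩG D (w.side .W) r) (hr : RootedFace D (w.side .W) r) (h : ω.IsB2a) :
    ω.rayCountAt hr h (holeFaceW w) .E = ((Finset.range ω.Mv).filter fun j => eastRayB w (ω.2.nth (ω.2.firstHitG + j + 1)) = true).card := by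
  classical
  unfold ΩG.rayCountAt
  congr 1
  refine Finset.filter_congr fun j hj => ?_
  rw [Finset.mem_range] at hj
  rw [← eastRayB_iff, side_jOut (hr := hr) h hj]

/-- ★ **COMBINATORIAL WOUNDNESS AT ANY ROOTED RHOMBUS**: an odd number of excursion mid-edges on the eastern ray of the hole makes `A_J(mid a) ≠ 0`.
[cite: CourantRobbins1958, Ch. V Appendix §2 (the even–odd rule)] [cite: GlazmanManolescu2019, Lemma 2.1] -/
theorem AJ_root_ne_zero_of_odd_card (ω : ΩG D (w.side .W) r) (hr : RootedFace D (w.side .W) r) (h : ω.IsB2a)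
    (hodd : Odd ((Finset.range ω.Mv).filter fun j => eastRayB w (ω.2.nth (ω.2.firstHitG + j + 1)) = true).card) :
    ω.AJ hr h (toC (midPt (w.side .W))) ≠ 0 := by
  rw [← rayCountAt_holeFaceW_E_eq_card_root ω hr h] at hodd
  exact (ω.AJ_root_ne_zero_iff_odd_rayCountAt (hr := hr) h (holeFaceW_side_E w)).2 hodd

/-- ★★★ **TRANSPORT OF A WOUND COST-`5` WITNESS TO EVERY POSITION.** A class-`B2a` walk of the back-translated list at the reference root plaquette `(4,2)` and
a reference rhombus `r₀`, with an odd eastern-ray count and limit cost `5`, yields in `dom Dl`, at the translated root and rhombus, a class-`B2a` walk that is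
WOUND (`A_J ≠ 0`) and of limit cost `5`. [cite: GlazmanManolescu2019, §4.2 (translation invariance), Lemma 2.1] [cite: Glazman2015WeightedSAW, Lemma 3.1 (proof, pp. 6–7)]
[cite: CourantRobbins1958, Ch. V Appendix §2 (the even–odd rule)] -/
theorem exists_wound_cost_five_shift {Dl : List Face} {w r₀ : Face} {a' : MidEdge} {r' : Face} (ha : (w42.side .W).shiftBy (refShift w) = a')
    (hrr : Face.shiftBy (refShift w) r₀ = r') (hr : RootedFace (dom Dl) a' r')
    (hr₀ : RootedFace (dom (Dl.map (Face.shiftBy (-refShift w)))) (w42.side .W) r₀)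
    (ω₀ : ΩG (dom (Dl.map (Face.shiftBy (-refShift w)))) (w42.side .W) r₀) (h₀ : ω₀.IsB2a)
    (hodd : Odd ((Finset.range ω₀.Mv).filter fun j => eastRayB w42 (ω₀.2.nth (ω₀.2.firstHitG + j + 1)) = true).card)
    (hc : cost (slotOfSide ω₀.1) ω₀.2.mids = 5) :
    ∃ (ω : ΩG (dom Dl) a' r') (h : ω.IsB2a), ω.AJ hr h (toC (midPt a')) ≠ 0 ∧ cost (slotOfSide ω.1) ω.2.mids = 5 := by
  subst ha hrr
  let ω : ΩG (dom Dl) ((w42.side .W).shiftBy (refShift w)) (Face.shiftBy (refShift w) r₀) :=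
    ⟨ω₀.1, (ω₀.2.shiftBy (refShift w)).castAll (preimage_dom_map_shiftBy_neg (refShift w) Dl) rfl
      (Face.side_shiftBy (refShift w) r₀ ω₀.1).symm⟩
  have hm : ω.2.mids = ω₀.2.mids.map (MidEdge.shiftBy (refShift w)) := rfl
  have h : ω.IsB2a := ΩG.isB2a_of_mids_shift hr₀ hm h₀
  refine ⟨ω, h, ?_, ?_⟩
  · -- odd eastern count ⇒ AJ ≠ 0 at the reference ⇒ odd `W`-ray count of the root plaquette, translation invariant ⇒ AJ ≠ 0 at the translate
    have hA₀ := AJ_root_ne_zero_of_odd_card ω₀ hr₀ h₀ hodd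
    have hW₀ := (ω₀.AJ_root_ne_zero_iff_odd_rayCountAt (hr := hr₀) h₀ (b := w42) (τ := .W) rfl).1 hA₀
    have hW : Odd (ω.rayCountAt hr h (Face.shiftBy (refShift w) w42) .W) := by
      rw [ΩG.rayCountAt_W_of_mids_shift (hr := hr₀) (hr' := hr) hm h₀ h w42]; exact hW₀
    exact (ω.AJ_root_ne_zero_iff_odd_rayCountAt (hr := hr) h (b := Face.shiftBy (refShift w) w42) (τ := .W)
      (Face.side_shiftBy (refShift w) w42 .W)).2 hW
  · show cost (slotOfSide ω₀.1) (ω₀.2.mids.map (MidEdge.shiftBy (refShift w))) = 5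
    rw [cost_map_shiftBy]; exact hc

end ΩG

end Literature.Probability.RandomPlanarGeometry.SAW.YangBaxter

/-! ## §2 The reference witnesses at the root plaquette `(4,2)`: the member 'ao' at the root-row rhombi `(4+k, 2)`, `k ≤ 3` -/

namespace Literature.Barriers.CriticalPhenomena.PlaquetteWalk

open Literature.Probability.RandomPlanarGeometry.SAW.YangBaxter
open Real Complex

section Reference

/-- The reference block of the root-row witness `k`: the cells `[2, 4+k] × [1, 3]` minus the hole `(3,2)` — the ring around the hole stretched `k` columns to
the east. [cite: GlazmanManolescu2019, §2.1 (finite domains of faces)] -/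
def rowBlock42 : ℕ → List Face
  | 0 => [(2,1),(2,2),(2,3),(3,1),(3,3),(4,1),(4,2),(4,3)]
  | 1 => [(2,1),(2,2),(2,3),(3,1),(3,3),(4,1),(4,2),(4,3),(5,1),(5,2),(5,3)]
  | 2 => [(2,1),(2,2),(2,3),(3,1),(3,3),(4,1),(4,2),(4,3),(5,1),(5,2),(5,3),(6,1),(6,2),(6,3)]
  | _ => [(2,1),(2,2),(2,3),(3,1),(3,3),(4,1),(4,2),(4,3),(5,1),(5,2),(5,3),(6,1),(6,2),(6,3),(7,1),(7,2),(7,3)]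

/-- The mid-edges of the root-row witness `k` (the census member 'ao' at `(4+k, 2)`): east along the root row into `(4+k,2)`, out through `N`, west along row `3`,
down column `2` past the hole, east along row `1`, into `(4+k,2)` from below. [cite: GlazmanManolescu2019, §1 (definition of the model), Fig. 1] -/
def rowMids42 : ℕ → List MidEdge
  | 0 => [.vert 4 2, .slant 4 3, .vert 4 3, .vert 3 3, .slant 2 3, .slant 2 2, .vert 3 1, .vert 4 1, .slant 4 2]
  | 1 => [.vert 4 2, .vert 5 2, .slant 5 3, .vert 5 3, .vert 4 3, .vert 3 3, .slant 2 3, .slant 2 2, .vert 3 1, .vert 4 1, .vert 5 1, .slant 5 2]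
  | 2 => [.vert 4 2, .vert 5 2, .vert 6 2, .slant 6 3, .vert 6 3, .vert 5 3, .vert 4 3, .vert 3 3, .slant 2 3, .slant 2 2, .vert 3 1, .vert 4 1,
      .vert 5 1, .vert 6 1, .slant 6 2]
  | _ => [.vert 4 2, .vert 5 2, .vert 6 2, .vert 7 2, .slant 7 3, .vert 7 3, .vert 6 3, .vert 5 3, .vert 4 3, .vert 3 3, .slant 2 3, .slant 2 2,
      .vert 3 1, .vert 4 1, .vert 5 1, .vert 6 1, .vert 7 1, .slant 7 2]

/-- The root-row witness `0` (the member 'ao' at the root plaquette itself) as a walk of its block. [cite: GlazmanManolescu2019, §1 (definition of the model), Fig. 1] -/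
def rowWalk0 : YBWalk (dom (rowBlock42 0)) (w42.side .W) (Face.side ((4 : ℤ), (2 : ℤ)) .S) where
  mids := rowMids42 0
  head_eq := by decide
  getLast_eq := by decide
  nodup := by decide
  arc_mem := arc_mem_of_check (by decide)
  isChain := by decide
  noncross := noncross_of_check (by decide)

/-- The root-row witness `1` as a walk of its block. [cite: GlazmanManolescu2019, §1 (definition of the model), Fig. 1] -/
def rowWalk1 : YBWalk (dom (rowBlock42 1)) (w42.side .W) (Face.side ((5 : ℤ), (2 : ℤ)) .S) where
  mids := rowMids42 1
  head_eq := by decide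
  getLast_eq := by decide
  nodup := by decide
  arc_mem := arc_mem_of_check (by decide)
  isChain := by decide
  noncross := noncross_of_check (by decide)

/-- The root-row witness `2` as a walk of its block. [cite: GlazmanManolescu2019, §1 (definition of the model), Fig. 1] -/
def rowWalk2 : YBWalk (dom (rowBlock42 2)) (w42.side .W) (Face.side ((6 : ℤ), (2 : ℤ)) .S) where
  mids := rowMids42 2
  head_eq := by decide
  getLast_eq := by decide
  nodup := by decide
  arc_mem := arc_mem_of_check (by decide)
  isChain := by decide
  noncross := noncross_of_check (by decide)

/-- The root-row witness `3` as a walk of its block. [cite: GlazmanManolescu2019, §1 (definition of the model), Fig. 1] -/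
def rowWalk3 : YBWalk (dom (rowBlock42 3)) (w42.side .W) (Face.side ((7 : ℤ), (2 : ℤ)) .S) where
  mids := rowMids42 3
  head_eq := by decide
  getLast_eq := by decide
  nodup := by decide
  arc_mem := arc_mem_of_check (by decide)
  isChain := by decide
  noncross := noncross_of_check (by decide)

/-- The labelled root-row witness `0` (returns to the `S` side). [cite: Glazman2015WeightedSAW, Lemma 3.1 (proof, pp. 6–7: the classes of walks through a rhombus)] -/
def ωR0 : ΩG (dom (rowBlock42 0)) (w42.side .W) ((4 : ℤ), (2 : ℤ)) := ⟨.S, rowWalk0⟩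
/-- The labelled root-row witness `1`. [cite: Glazman2015WeightedSAW, Lemma 3.1 (proof, pp. 6–7)] -/
def ωR1 : ΩG (dom (rowBlock42 1)) (w42.side .W) ((5 : ℤ), (2 : ℤ)) := ⟨.S, rowWalk1⟩
/-- The labelled root-row witness `2`. [cite: Glazman2015WeightedSAW, Lemma 3.1 (proof, pp. 6–7)] -/
def ωR2 : ΩG (dom (rowBlock42 2)) (w42.side .W) ((6 : ℤ), (2 : ℤ)) := ⟨.S, rowWalk2⟩
/-- The labelled root-row witness `3`. [cite: Glazman2015WeightedSAW, Lemma 3.1 (proof, pp. 6–7)] -/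
def ωR3 : ΩG (dom (rowBlock42 3)) (w42.side .W) ((7 : ℤ), (2 : ℤ)) := ⟨.S, rowWalk3⟩

/-- Certificates of the root-row witness `0`: first hit `0`, `8` arcs, no later arc in the rhombus, ONE eastern-ray crossing (odd), limit cost `5`.
[cite: Glazman2015WeightedSAW, Lemma 3.1 (proof, pp. 6–7)] [cite: CourantRobbins1958, Ch. V Appendix §2 (the even–odd rule)] [cite: GlazmanManolescu2019, §1, eq. (1); Remark 2.2] -/
theorem ωR0_cert : ωR0.2.firstHitG = 0 ∧ ωR0.2.arcs.length = 8 ∧ (∀ j < 8, 0 < j → ωR0.2.fc j ≠ ((4 : ℤ), (2 : ℤ))) ∧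
    Odd ((Finset.range 8).filter fun j => eastRayB w42 (ωR0.2.nth (0 + j + 1)) = true).card ∧ cost (slotOfSide ωR0.1) ωR0.2.mids = 5 := by
  refine ⟨by decide, by decide, by decide, by decide, by decide⟩

/-- Certificates of the root-row witness `1`: first hit `1`, `11` arcs, no later arc in the rhombus, odd eastern-ray count, cost `5`.
[cite: Glazman2015WeightedSAW, Lemma 3.1 (proof, pp. 6–7)] [cite: CourantRobbins1958, Ch. V Appendix §2 (the even–odd rule)] [cite: GlazmanManolescu2019, §1, eq. (1); Remark 2.2] -/
theorem ωR1_cert : ωR1.2.firstHitG = 1 ∧ ωR1.2.arcs.length = 11 ∧ (∀ j < 11, 1 < j → ωR1.2.fc j ≠ ((5 : ℤ), (2 : ℤ))) ∧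
    Odd ((Finset.range 10).filter fun j => eastRayB w42 (ωR1.2.nth (1 + j + 1)) = true).card ∧ cost (slotOfSide ωR1.1) ωR1.2.mids = 5 := by
  refine ⟨by decide, by decide, by decide, by decide, by decide⟩

/-- Certificates of the root-row witness `2`: first hit `2`, `14` arcs, no later arc in the rhombus, odd eastern-ray count, cost `5`.
[cite: Glazman2015WeightedSAW, Lemma 3.1 (proof, pp. 6–7)] [cite: CourantRobbins1958, Ch. V Appendix §2 (the even–odd rule)] [cite: GlazmanManolescu2019, §1, eq. (1); Remark 2.2] -/
theorem ωR2_cert : ωR2.2.firstHitG = 2 ∧ ωR2.2.arcs.length = 14 ∧ (∀ j < 14, 2 < j → ωR2.2.fc j ≠ ((6 : ℤ), (2 : ℤ))) ∧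
    Odd ((Finset.range 12).filter fun j => eastRayB w42 (ωR2.2.nth (2 + j + 1)) = true).card ∧ cost (slotOfSide ωR2.1) ωR2.2.mids = 5 := by
  refine ⟨by decide, by decide, by decide, by decide, by decide⟩

/-- Certificates of the root-row witness `3`: first hit `3`, `17` arcs, no later arc in the rhombus, odd eastern-ray count, cost `5`.
[cite: Glazman2015WeightedSAW, Lemma 3.1 (proof, pp. 6–7)] [cite: CourantRobbins1958, Ch. V Appendix §2 (the even–odd rule)] [cite: GlazmanManolescu2019, §1, eq. (1); Remark 2.2] -/
theorem ωR3_cert : ωR3.2.firstHitG = 3 ∧ ωR3.2.arcs.length = 17 ∧ (∀ j < 17, 3 < j → ωR3.2.fc j ≠ ((7 : ℤ), (2 : ℤ))) ∧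
    Odd ((Finset.range 14).filter fun j => eastRayB w42 (ωR3.2.nth (3 + j + 1)) = true).card ∧ cost (slotOfSide ωR3.1) ωR3.2.mids = 5 := by
  refine ⟨by decide, by decide, by decide, by decide, by decide⟩

end Reference

/-! ## §3 Every position -/

section Translate

variable {Dl : List Face} {w : Face}

/-- The root-row witness block `k` at the root plaquette `w`: the translate of `rowBlock42 k` — the cells `[w.1 − 2, w.1 + k] × [w.2 − 1, w.2 + 1]` minus the hole
`(w.1 − 1, w.2)` (for `k ≤ 3`). [cite: GlazmanManolescu2019, §2.1, §4.2 (translation invariance)] -/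
def rowBlock (w : Face) (k : ℕ) : List Face := (rowBlock42 k).map (Face.shiftBy (refShift w))

/-- The translation carries the reference root-row rhombus `(4+k, 2)` to `(w.1 + k, w.2)`. [cite: GlazmanManolescu2019, §4.2 (translation invariance)] -/
theorem shiftBy_refShift_rootRow (w : Face) (k : ℤ) : Face.shiftBy (refShift w) (((4 : ℤ) + k, (2 : ℤ)) : Face) = (w.1 + k, w.2) := by
  obtain ⟨x, y⟩ := w; simp [Face.shiftBy, refShift]; ring

/-- The rooted rhombus at the reference position, from the rooted rhombus at the translated position. [cite: GlazmanManolescu2019, §2.1 (walks start on the boundary), §4.2] -/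
theorem rootedFace_refShift_back' {a' : MidEdge} {r₀ r' : Face} (ha : (w42.side .W).shiftBy (refShift w) = a')
    (hrr : Face.shiftBy (refShift w) r₀ = r') (hr : RootedFace (dom Dl) a' r') :
    RootedFace (dom (Dl.map (Face.shiftBy (-refShift w)))) (w42.side .W) r₀ := by
  subst ha hrr
  refine ⟨(mem_dom_map_shiftBy_neg _ Dl _).2 hr.mem, fun hb => hr.root ?_⟩
  rw [MidEdge.faces_shiftBy]
  exact ⟨(mem_dom_map_shiftBy_neg _ Dl _).1 hb.1, (mem_dom_map_shiftBy_neg _ Dl _).1 hb.2⟩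

/-- The reference witness `k`, placed in the back-translated list containing its block: class `B2a`, odd eastern-ray count, limit cost `5` (one lemma per `k`).
[cite: Glazman2015WeightedSAW, Lemma 3.1 (proof, pp. 6–7)] [cite: CourantRobbins1958, Ch. V Appendix §2 (the even–odd rule)] -/
private theorem refWitness0 (hB₀ : ∀ c ∈ rowBlock42 0, c ∈ Dl.map (Face.shiftBy (-refShift w))) :
    ∃ (ω₀ : ΩG (dom (Dl.map (Face.shiftBy (-refShift w)))) (w42.side .W) ((4 : ℤ), (2 : ℤ))) (_ : ω₀.IsB2a),
      Odd ((Finset.range ω₀.Mv).filter fun j => eastRayB w42 (ω₀.2.nth (ω₀.2.firstHitG + j + 1)) = true).card ∧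
      cost (slotOfSide ω₀.1) ω₀.2.mids = 5 := by
  obtain ⟨hF, hn, hfc, hodd, hc⟩ := ωR0_cert
  let ω₀ : ΩG (dom (Dl.map (Face.shiftBy (-refShift w)))) (w42.side .W) ((4 : ℤ), (2 : ℤ)) := ⟨.S, rowWalk0.mapDomain fun c hc => hB₀ c hc⟩
  have hF' : ω₀.2.firstHitG = 0 := hF
  have hn' : ω₀.2.arcs.length = 8 := hn
  have h₀ : ω₀.IsB2a := by
    refine ΩG.isB2a_of_forall_fc_ne (by rw [hF', hn']; omega) fun j hj1 hj2 => ?_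
    rw [hF'] at hj1; rw [hn'] at hj2
    exact hfc j hj2 hj1
  have hM : ω₀.Mv = 8 := by unfold ΩG.Mv; rw [hF', hn']
  exact ⟨ω₀, h₀, by rw [hM, hF']; exact hodd, hc⟩

/-- The reference witness `1` in the back-translated list. [cite: Glazman2015WeightedSAW, Lemma 3.1 (proof, pp. 6–7)] [cite: CourantRobbins1958, Ch. V Appendix §2 (the even–odd rule)] -/
private theorem refWitness1 (hB₀ : ∀ c ∈ rowBlock42 1, c ∈ Dl.map (Face.shiftBy (-refShift w))) :
    ∃ (ω₀ : ΩG (dom (Dl.map (Face.shiftBy (-refShift w)))) (w42.side .W) ((5 : ℤ), (2 : ℤ))) (_ : ω₀.IsB2a),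
      Odd ((Finset.range ω₀.Mv).filter fun j => eastRayB w42 (ω₀.2.nth (ω₀.2.firstHitG + j + 1)) = true).card ∧
      cost (slotOfSide ω₀.1) ω₀.2.mids = 5 := by
  obtain ⟨hF, hn, hfc, hodd, hc⟩ := ωR1_cert
  let ω₀ : ΩG (dom (Dl.map (Face.shiftBy (-refShift w)))) (w42.side .W) ((5 : ℤ), (2 : ℤ)) := ⟨.S, rowWalk1.mapDomain fun c hc => hB₀ c hc⟩
  have hF' : ω₀.2.firstHitG = 1 := hF
  have hn' : ω₀.2.arcs.length = 11 := hn
  have h₀ : ω₀.IsB2a := by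
    refine ΩG.isB2a_of_forall_fc_ne (by rw [hF', hn']; omega) fun j hj1 hj2 => ?_
    rw [hF'] at hj1; rw [hn'] at hj2
    exact hfc j hj2 hj1
  have hM : ω₀.Mv = 10 := by unfold ΩG.Mv; rw [hF', hn']
  exact ⟨ω₀, h₀, by rw [hM, hF']; exact hodd, hc⟩

/-- The reference witness `2` in the back-translated list. [cite: Glazman2015WeightedSAW, Lemma 3.1 (proof, pp. 6–7)] [cite: CourantRobbins1958, Ch. V Appendix §2 (the even–odd rule)] -/
private theorem refWitness2 (hB₀ : ∀ c ∈ rowBlock42 2, c ∈ Dl.map (Face.shiftBy (-refShift w))) :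
    ∃ (ω₀ : ΩG (dom (Dl.map (Face.shiftBy (-refShift w)))) (w42.side .W) ((6 : ℤ), (2 : ℤ))) (_ : ω₀.IsB2a),
      Odd ((Finset.range ω₀.Mv).filter fun j => eastRayB w42 (ω₀.2.nth (ω₀.2.firstHitG + j + 1)) = true).card ∧
      cost (slotOfSide ω₀.1) ω₀.2.mids = 5 := by
  obtain ⟨hF, hn, hfc, hodd, hc⟩ := ωR2_cert
  let ω₀ : ΩG (dom (Dl.map (Face.shiftBy (-refShift w)))) (w42.side .W) ((6 : ℤ), (2 : ℤ)) := ⟨.S, rowWalk2.mapDomain fun c hc => hB₀ c hc⟩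
  have hF' : ω₀.2.firstHitG = 2 := hF
  have hn' : ω₀.2.arcs.length = 14 := hn
  have h₀ : ω₀.IsB2a := by
    refine ΩG.isB2a_of_forall_fc_ne (by rw [hF', hn']; omega) fun j hj1 hj2 => ?_
    rw [hF'] at hj1; rw [hn'] at hj2
    exact hfc j hj2 hj1
  have hM : ω₀.Mv = 12 := by unfold ΩG.Mv; rw [hF', hn']
  exact ⟨ω₀, h₀, by rw [hM, hF']; exact hodd, hc⟩

/-- The reference witness `3` in the back-translated list. [cite: Glazman2015WeightedSAW, Lemma 3.1 (proof, pp. 6–7)] [cite: CourantRobbins1958, Ch. V Appendix §2 (the even–odd rule)] -/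
private theorem refWitness3 (hB₀ : ∀ c ∈ rowBlock42 3, c ∈ Dl.map (Face.shiftBy (-refShift w))) :
    ∃ (ω₀ : ΩG (dom (Dl.map (Face.shiftBy (-refShift w)))) (w42.side .W) ((7 : ℤ), (2 : ℤ))) (_ : ω₀.IsB2a),
      Odd ((Finset.range ω₀.Mv).filter fun j => eastRayB w42 (ω₀.2.nth (ω₀.2.firstHitG + j + 1)) = true).card ∧
      cost (slotOfSide ω₀.1) ω₀.2.mids = 5 := by
  obtain ⟨hF, hn, hfc, hodd, hc⟩ := ωR3_cert
  let ω₀ : ΩG (dom (Dl.map (Face.shiftBy (-refShift w)))) (w42.side .W) ((7 : ℤ), (2 : ℤ)) := ⟨.S, rowWalk3.mapDomain fun c hc => hB₀ c hc⟩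
  have hF' : ω₀.2.firstHitG = 3 := hF
  have hn' : ω₀.2.arcs.length = 17 := hn
  have h₀ : ω₀.IsB2a := by
    refine ΩG.isB2a_of_forall_fc_ne (by rw [hF', hn']; omega) fun j hj1 hj2 => ?_
    rw [hF'] at hj1; rw [hn'] at hj2
    exact hfc j hj2 hj1
  have hM : ω₀.Mv = 14 := by unfold ΩG.Mv; rw [hF', hn']
  exact ⟨ω₀, h₀, by rw [hM, hF']; exact hodd, hc⟩

/-- ★★★★ **A WOUND COST-`5` MEMBER AT EVERY ROOT-ROW RHOMBUS WITH ROOM FOR THE RING, EVERY POSITION** (`k ≤ 3`): every face list containing the block `rowBlock w k`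
carries a class-`B2a` walk at `(w.1 + k, w.2)` from the root `w.side W` that is WOUND (`A_J ≠ 0`) and of limit cost `5` — the hypothesis `hex` of the root-row law.
[cite: GlazmanManolescu2019, §4.2 (translation invariance), Lemma 2.1; §1 eq. (1)] [cite: Glazman2015WeightedSAW, Lemma 3.1 (proof, pp. 6–7)]
[cite: CourantRobbins1958, Ch. V Appendix §2 (the even–odd rule)] -/
theorem exists_wound_cost_five_of_rowBlock {k : ℕ} (hk : k ≤ 3) (hB : ∀ c ∈ rowBlock w k, c ∈ Dl)
    (hr : RootedFace (dom Dl) (w.side .W) (w.1 + k, w.2)) :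
    ∃ (ω : ΩG (dom Dl) (w.side .W) (w.1 + k, w.2)) (h : ω.IsB2a),
      ω.AJ hr h (toC (midPt (w.side .W))) ≠ 0 ∧ cost (slotOfSide ω.1) ω.2.mids = 5 := by
  have hB₀ := block42_mem_of_block_mem (B := rowBlock42 k) hB
  interval_cases k
  · have hrr : Face.shiftBy (refShift w) (((4 : ℤ), (2 : ℤ)) : Face) = (w.1 + ((0 : ℕ) : ℤ), w.2) := by
      have := shiftBy_refShift_rootRow w 0; simpa using this
    obtain ⟨ω₀, h₀, hodd, hc⟩ := refWitness0 hB₀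
    exact ΩG.exists_wound_cost_five_shift (shiftBy_refShift_root w) hrr hr
      (rootedFace_refShift_back' (shiftBy_refShift_root w) hrr hr) ω₀ h₀ hodd hc
  · have hrr : Face.shiftBy (refShift w) (((5 : ℤ), (2 : ℤ)) : Face) = (w.1 + ((1 : ℕ) : ℤ), w.2) := by
      have := shiftBy_refShift_rootRow w 1; simpa using this
    obtain ⟨ω₀, h₀, hodd, hc⟩ := refWitness1 hB₀
    exact ΩG.exists_wound_cost_five_shift (shiftBy_refShift_root w) hrr hr
      (rootedFace_refShift_back' (shiftBy_refShift_root w) hrr hr) ω₀ h₀ hodd hc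
  · have hrr : Face.shiftBy (refShift w) (((6 : ℤ), (2 : ℤ)) : Face) = (w.1 + ((2 : ℕ) : ℤ), w.2) := by
      have := shiftBy_refShift_rootRow w 2; simpa using this
    obtain ⟨ω₀, h₀, hodd, hc⟩ := refWitness2 hB₀
    exact ΩG.exists_wound_cost_five_shift (shiftBy_refShift_root w) hrr hr
      (rootedFace_refShift_back' (shiftBy_refShift_root w) hrr hr) ω₀ h₀ hodd hc
  · have hrr : Face.shiftBy (refShift w) (((7 : ℤ), (2 : ℤ)) : Face) = (w.1 + ((3 : ℕ) : ℤ), w.2) := by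
      have := shiftBy_refShift_rootRow w 3; simpa using this
    obtain ⟨ω₀, h₀, hodd, hc⟩ := refWitness3 hB₀
    exact ΩG.exists_wound_cost_five_shift (shiftBy_refShift_root w) hrr hr
      (rootedFace_refShift_back' (shiftBy_refShift_root w) hrr hr) ω₀ h₀ hodd hc

/-- ★★★★★ **THE ROOT-ROW LAW, CLOSED FORM.** For every finite face list `Dl` missing the hole `(w.1 − 1, w.2)` and containing the block `rowBlock w k` (`k ≤ 3`), the
printed Yang–Baxter vertex functional at the root `w.side W` and the root-row rhombus `(w.1 + k, w.2)` has finitely many zeros in `(0, π)`, at most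
`4·maxExp − 4`. [cite: GlazmanManolescu2019, Lemma 2.1 and eq. (1); Remark 2.2; §4.2] [cite: Glazman2015WeightedSAW, Lemma 3.1 (proof, pp. 6–7)] -/
theorem vertexFunctional_printed_zero_set_finite_of_rowBlock {k : ℕ} (hk : k ≤ 3) (hh : holeFaceW w ∉ dom Dl)
    (hB : ∀ c ∈ rowBlock w k, c ∈ Dl) (hr : RootedFace (dom Dl) (w.side .W) (w.1 + k, w.2)) :
    {θ ∈ Set.Ioo 0 π | vertexFunctional (printedWeights θ) tFiveEighths (ybCoeff θ) Dl (w.side .W) (w.1 + k, w.2) = 0}.Finite ∧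
      {θ ∈ Set.Ioo 0 π | vertexFunctional (printedWeights θ) tFiveEighths (ybCoeff θ) Dl (w.side .W) (w.1 + k, w.2) = 0}.ncard ≤
        4 * maxExp Dl (w.side .W) (w.1 + k, w.2) + 1 - 5 := by
  obtain ⟨ω, h, hA, hc⟩ := exists_wound_cost_five_of_rowBlock hk hB hr
  exact vertexFunctional_printed_zero_set_finite_of_rootRow Dl hh hr rfl (by simp only; omega) ⟨ω, h, hA, hc⟩

/-- ★★★★★ **NOT IDENTICALLY ZERO, CLOSED FORM**: under the same hypotheses some `θ ∈ (0, π)` has `VF_D(w.side W, (w.1 + k, w.2); θ) ≠ 0`.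
[cite: GlazmanManolescu2019, Lemma 2.1 and eq. (1); Remark 2.2; §4.2] [cite: Glazman2015WeightedSAW, Lemma 3.1 (proof, pp. 6–7)] -/
theorem vertexFunctional_printed_exists_ne_zero_of_rowBlock {k : ℕ} (hk : k ≤ 3) (hh : holeFaceW w ∉ dom Dl)
    (hB : ∀ c ∈ rowBlock w k, c ∈ Dl) (hr : RootedFace (dom Dl) (w.side .W) (w.1 + k, w.2)) :
    ∃ θ ∈ Set.Ioo 0 π, vertexFunctional (printedWeights θ) tFiveEighths (ybCoeff θ) Dl (w.side .W) (w.1 + k, w.2) ≠ 0 := by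
  obtain ⟨ω, h, hA, hc⟩ := exists_wound_cost_five_of_rowBlock hk hB hr
  exact vertexFunctional_printed_exists_ne_zero_of_rootRow Dl hh hr rfl (by simp only; omega) ⟨ω, h, hA, hc⟩

end Translate

end Literature.Barriers.CriticalPhenomena.PlaquetteWalk
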